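import Mathlib.Analysis.Normed.Operator.Banach
import Mathlib.Analysis.Normed.Operator.Compact.Basic
import Mathlib.Analysis.Normed.Module.RCLike.Basic
import Mathlib.Topology.Algebra.Module.FiniteDimension
import Mathlib.Analysis.SpecificLimits.Normed
import HarnessLib

/-!
# Finite-dimensionality of cohomology from a compact restriction (L. Schwartz / Cartan–Serre / Forster)

Topic `Literature/Analysis/OperatorTheory`. The functional-analytic heart of the Cartan–Serre
finiteness theorem (H. Cartan, J.-P. Serre, *Un théorème de finitude concernant les variétés
analytiques compactes*, C. R. Acad. Sci. Paris 237 (1953) 128–130, via L. Schwartz's theorem on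
compact perturbations of surjections), in the Banach-space form printed by H. Grauert, R. Remmert,
*Theorie der Steinschen Räume* (1977), Kap. VI §4 ("Glättungslemma", "Endlichkeitslemma",
"Endlichkeitssatz", pp. 202–205; held copy read, PDF pp. 876–879) and by O. Forster, *Lectures on
Riemann Surfaces*, GTM 81 (1981), §14 (proof of Thm. 14.9, `dim H¹(X, 𝒪) < ∞`), abstracted from
Čech cochains to four normed spaces and three bounded operators:

* `X` ("cocycles on the big cover"), `Y` ("cocycles on the middle cover"), `V` ("cocycles on the
  small cover"), `W` ("cochains of one degree less on the small cover");
* `r₁ : X → Y`, `r₂ : Y → V` ("restrictions"), `d : W → V` ("coboundary").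

Results (everything PROVED, Mathlib only; no definitions):

* `exists_finiteDimensional_norm_sub_le_of_isCompactOperator` — **a compact operator is, up to
  `ε‖x‖`, valued in a finite-dimensional subspace**: if `r : X → Y` is compact and `ε > 0` there
  is a finite-dimensional `S ≤ Y` with `dist (r x, S) ≤ ε ‖x‖` for all `x` (total boundedness of
  the image of the unit ball; this replaces inequality (1) of Grauert–Remmert's §4.2, obtained
  there from a monotone orthogonal basis of a Bergman space, and Forster's Lemma 14.4).
* `exists_norm_le_of_forall_exists_eq_add` — **norm control by the open mapping theorem**
  (Grauert–Remmert, Kap. VI §4.1 "Glättungslemma": "Nach dem Satz von Banach ist `α` daher offen";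
  Forster, Lemma 14.6): if `X, W, Y` are complete and every `y` admits `x, w` with
  `r₂ (r₁ x) = r₂ y + d w`, then they can be chosen with `‖x‖, ‖w‖ ≤ C ‖y‖` (Banach's theorem
  `ContinuousLinearMap.exists_preimage_norm_le` for the projection of the closed relation
  subspace onto `Y`).
* `exists_finiteDimensional_forall_eq_add_of_isCompactOperator` — **the iteration**
  (Grauert–Remmert, Kap. VI §4.2 "Endlichkeitslemma", `t = L M a^e < 1`; Forster, proof of
  Thm. 14.9): if `Y, W` are complete, `r₁` is compact and the controlled solvability above holds,
  then there is a finite-dimensional `S ≤ Y` with `r₂ y ∈ r₂ S + range d` for every `y ∈ Y`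
  (choose `ε` with `2 ε C ≤ 1`; `r₁ x = s + y₁`, `s ∈ S`, `‖y₁‖ ≤ ½‖y‖`; sum the geometric series).
* `Module.finite_of_compact_restriction` — **the finiteness theorem in abstract form**
  (Grauert–Remmert, Kap. VI §4.3 "Endlichkeitssatz" as the corollary of the Endlichkeitslemma):
  if moreover a linear "class map" `cls : V → H` kills `range d` and every element of `H` is the
  class of some `r₂ y`, then `H` is finite-dimensional.

The Čech/Leray bookkeeping that feeds these hypotheses for the Dolbeault cohomology of a compact
complex manifold lives in the geometric files; here nothing refers to manifolds.

## References

* H. Grauert, R. Remmert, *Theorie der Steinschen Räume*, Grundlehren 227, Springer (1977),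
  Kap. VI §4 (Glättungslemma, Endlichkeitslemma, Endlichkeitssatz), pp. 202–205.
  [GrauertRemmert1977]
* H. Cartan, J.-P. Serre, C. R. Acad. Sci. Paris 237 (1953) 128–130. [CartanSerre1953]
* L. Schwartz, *Homomorphismes et applications complètement continues*, C. R. Acad. Sci. Paris 236
  (1953) 2472–2473.
* O. Forster, *Lectures on Riemann Surfaces*, GTM 81, Springer (1981), §14: Lemma 14.4, Lemma 14.6,
  Thm. 14.9 and its proof. [Forster1981]
* R. C. Gunning, H. Rossi, *Analytic Functions of Several Complex Variables* (1965), Ch. VIII §A.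
-/

open Filter Topology Set Metric Function

namespace Literature.Analysis.OperatorTheory

section

variable {𝕜 : Type*} [RCLike 𝕜]
  {X Y V W : Type*} [NormedAddCommGroup X] [NormedSpace 𝕜 X] [NormedAddCommGroup Y] [NormedSpace 𝕜 Y]
  [NormedAddCommGroup V] [NormedSpace 𝕜 V] [NormedAddCommGroup W] [NormedSpace 𝕜 W]

/-! ### A compact operator is almost finite-dimensional-valued -/

/-- **A compact operator takes values, up to `ε ‖x‖`, in a finite-dimensional subspace**: for a
compact `r : X → Y` and `ε > 0` there is a finite-dimensional `S ≤ Y` such that every `r x` is within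
`ε ‖x‖` of `S`. Proof: the image of the closed unit ball is totally bounded; let `S` be the span of
a finite `ε`-net of it and rescale. Replaces inequality (1) of Grauert–Remmert (1977), Kap. VI
§4.2 (there from a monotone orthogonal basis) / Forster (1981), Lemma 14.4.
[cite: GrauertRemmert1977, Kap. VI §4.2 (1)] -/
theorem exists_finiteDimensional_norm_sub_le_of_isCompactOperator {r : X →L[𝕜] Y}
    (hr : IsCompactOperator r) {ε : ℝ} (hε : 0 < ε) :
    ∃ S : Submodule 𝕜 Y, FiniteDimensional 𝕜 S ∧ ∀ x : X, ∃ s ∈ S, ‖r x - s‖ ≤ ε * ‖x‖ := by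
  have htb : TotallyBounded (r '' closedBall (0 : X) 1) :=
    (hr.isCompact_closure_image_closedBall 1).totallyBounded.subset subset_closure
  obtain ⟨t, htfin, ht⟩ := Metric.totallyBounded_iff.1 htb ε hε
  refine ⟨Submodule.span 𝕜 t, FiniteDimensional.span_of_finite 𝕜 htfin, fun x ↦ ?_⟩
  by_cases hx : x = 0
  · exact ⟨0, Submodule.zero_mem _, by simp [hx]⟩
  set u : X := ((‖x‖ : ℝ) : 𝕜)⁻¹ • x with hu
  have hu1 : ‖u‖ = 1 := norm_smul_inv_norm hx
  have hxu : x = ((‖x‖ : ℝ) : 𝕜) • u := by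
    rw [hu, smul_smul, mul_inv_cancel₀ (RCLike.ofReal_ne_zero.2 (norm_ne_zero_iff.2 hx)), one_smul]
  have hru : r u ∈ r '' closedBall (0 : X) 1 := ⟨u, by simp [hu1], rfl⟩
  obtain ⟨y, hyt, hy⟩ : ∃ y ∈ t, r u ∈ ball y ε := by simpa only [mem_iUnion, exists_prop] using ht hru
  refine ⟨((‖x‖ : ℝ) : 𝕜) • y, Submodule.smul_mem _ _ (Submodule.subset_span hyt), ?_⟩
  have h1 : r x - ((‖x‖ : ℝ) : 𝕜) • y = ((‖x‖ : ℝ) : 𝕜) • (r u - y) := by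
    rw [smul_sub, ← map_smul, ← hxu]
  rw [h1, norm_smul, RCLike.norm_ofReal, abs_norm, mul_comm]
  gcongr
  rw [← dist_eq_norm]
  exact (mem_ball.1 hy).le

/-! ### Norm control by the open mapping theorem -/

/-- **Norm control of the solutions by the open mapping theorem** (the "Glättungslemma" of
Grauert–Remmert (1977), Kap. VI §4.1: "Nach dem Satz von Banach ist `α` daher offen … `L := ρ⁻¹`";
Forster (1981), Lemma 14.6). Let `X, W, Y` be Banach spaces, `V` a normed space, `r₁ : X → Y`,
`r₂ : Y → V`, `d : W → V` bounded. If for every `y` there are `x, w` with `r₂ (r₁ x) = r₂ y + d w`,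
then there is `C > 0` such that they can be chosen with `‖x‖ ≤ C ‖y‖` and `‖w‖ ≤ C ‖y‖`: the
relation `{(x, w, y) | r₂ (r₁ x) = r₂ y + d w}` is a closed subspace of `X × W × Y`, hence complete,
and the projection onto `Y` is a bounded surjection, to which Banach's theorem
(`ContinuousLinearMap.exists_preimage_norm_le`) applies. [cite: GrauertRemmert1977, Kap. VI §4.1] -/
theorem exists_norm_le_of_forall_exists_eq_add [CompleteSpace X] [CompleteSpace W] [CompleteSpace Y]
    (r₁ : X →L[𝕜] Y) (r₂ : Y →L[𝕜] V) (d : W →L[𝕜] V)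
    (h : ∀ y : Y, ∃ x : X, ∃ w : W, r₂ (r₁ x) = r₂ y + d w) :
    ∃ C : ℝ, 0 < C ∧ ∀ y : Y, ∃ x : X, ∃ w : W,
      r₂ (r₁ x) = r₂ y + d w ∧ ‖x‖ ≤ C * ‖y‖ ∧ ‖w‖ ≤ C * ‖y‖ := by
  -- the relation as the kernel of a bounded map `X × W × Y → V`
  let Φ : (X × W × Y) →L[𝕜] V :=
    (r₂.comp r₁).comp (ContinuousLinearMap.fst 𝕜 X (W × Y)) -
      (r₂.comp ((ContinuousLinearMap.snd 𝕜 W Y).comp (ContinuousLinearMap.snd 𝕜 X (W × Y))) +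
        d.comp ((ContinuousLinearMap.fst 𝕜 W Y).comp (ContinuousLinearMap.snd 𝕜 X (W × Y))))
  have hΦ : ∀ p : X × W × Y, Φ p = r₂ (r₁ p.1) - (r₂ p.2.2 + d p.2.1) := fun p ↦ rfl
  let P : Submodule 𝕜 (X × W × Y) := LinearMap.ker (Φ : (X × W × Y) →ₗ[𝕜] V)
  have hPc : IsClosed (P : Set (X × W × Y)) := Φ.isClosed_ker
  haveI : CompleteSpace P := hPc.completeSpace_coe
  -- the projection `P → Y`
  let π : P →L[𝕜] Y :=
    ((ContinuousLinearMap.snd 𝕜 W Y).comp (ContinuousLinearMap.snd 𝕜 X (W × Y))).comp P.subtypeL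
  have hπ : ∀ p : P, π p = (p : X × W × Y).2.2 := fun p ↦ rfl
  have hsurj : Surjective π := by
    intro y
    obtain ⟨x, w, hxw⟩ := h y
    refine ⟨⟨(x, w, y), ?_⟩, rfl⟩
    change Φ (x, w, y) = 0
    rw [hΦ, hxw, sub_self]
  obtain ⟨C, hC0, hC⟩ := π.exists_preimage_norm_le hsurj
  refine ⟨C, hC0, fun y ↦ ?_⟩
  obtain ⟨p, hpy, hpn⟩ := hC y
  have hp0 : Φ (p : X × W × Y) = 0 := p.2
  rw [hΦ, sub_eq_zero] at hp0
  rw [hπ] at hpy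
  refine ⟨(p : X × W × Y).1, (p : X × W × Y).2.1, ?_, ?_, ?_⟩
  · rw [hp0, hpy]
  · exact (norm_fst_le (p : X × W × Y)).trans hpn
  · exact ((norm_fst_le _).trans (norm_snd_le (p : X × W × Y))).trans hpn

/-! ### The iteration -/

/-- **The iteration of the Endlichkeitslemma** (Grauert–Remmert (1977), Kap. VI §4.2, with
`t = L M aᵉ < 1`; Forster (1981), proof of Thm. 14.9; the Banach-space form of L. Schwartz's
argument in Cartan–Serre (1953)). Let `Y, W` be Banach spaces, `X, V` normed spaces,
`r₁ : X → Y` a COMPACT operator, `r₂ : Y → V`, `d : W → V` bounded, and suppose there is a constant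
`C` such that every `y ∈ Y` admits `x ∈ X`, `w ∈ W` with `r₂ (r₁ x) = r₂ y + d w`, `‖x‖ ≤ C ‖y‖`,
`‖w‖ ≤ C ‖y‖`. Then there is a finite-dimensional subspace `S ≤ Y` such that for every `y ∈ Y`,
`r₂ y = r₂ s + d w` for some `s ∈ S`, `w ∈ W`. Proof: with `2 ε C ≤ 1` and `S` as in
`exists_finiteDimensional_norm_sub_le_of_isCompactOperator`, write `r₁ x = s₀ + y₁` with `s₀ ∈ S`,
`‖y₁‖ ≤ ε ‖x‖ ≤ ½ ‖y‖`, so `r₂ y = r₂ s₀ + r₂ y₁ - d w₀`; iterate on `y₁` and sum the two geometric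
series (`S` is closed, being finite-dimensional). [cite: GrauertRemmert1977, Kap. VI §4.2] -/
theorem exists_finiteDimensional_forall_eq_add_of_isCompactOperator [CompleteSpace Y] [CompleteSpace W]
    (r₁ : X →L[𝕜] Y) (r₂ : Y →L[𝕜] V) (d : W →L[𝕜] V) (hr₁ : IsCompactOperator r₁) {C : ℝ}
    (hA : ∀ y : Y, ∃ x : X, ∃ w : W, r₂ (r₁ x) = r₂ y + d w ∧ ‖x‖ ≤ C * ‖y‖ ∧ ‖w‖ ≤ C * ‖y‖) :
    ∃ S : Submodule 𝕜 Y, FiniteDimensional 𝕜 S ∧ ∀ y : Y, ∃ s ∈ S, ∃ w : W, r₂ y = r₂ s + d w := by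
  -- solution operators (not linear, not continuous: mere choice functions)
  choose fx fw hrel hx hw using hA
  -- a nonnegative constant dominating `C`
  set C' : ℝ := max C 1 with hC'
  have hC'1 : 1 ≤ C' := le_max_right _ _
  have hC'0 : 0 < C' := lt_of_lt_of_le one_pos hC'1
  have hx' : ∀ y, ‖fx y‖ ≤ C' * ‖y‖ := fun y ↦ (hx y).trans (by gcongr; exact le_max_left _ _)
  have hw' : ∀ y, ‖fw y‖ ≤ C' * ‖y‖ := fun y ↦ (hw y).trans (by gcongr; exact le_max_left _ _)
  -- the finite-dimensional subspace, for `ε = (2 C')⁻¹`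
  set ε : ℝ := (2 * C')⁻¹ with hεdef
  have hε : 0 < ε := by positivity
  have hεC : ε * C' = 1 / 2 := by rw [hεdef]; field_simp
  obtain ⟨S, hS, hB⟩ := exists_finiteDimensional_norm_sub_le_of_isCompactOperator hr₁ hε
  choose fs hfsS hfs using hB
  refine ⟨S, hS, fun y₀ ↦ ?_⟩
  -- one step of the iteration and its contraction property
  let step : Y → Y := fun y ↦ r₁ (fx y) - fs (fx y)
  have hstep : ∀ y, ‖step y‖ ≤ 1 / 2 * ‖y‖ := fun y ↦ by
    calc ‖step y‖ ≤ ε * ‖fx y‖ := hfs (fx y)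
      _ ≤ ε * (C' * ‖y‖) := by gcongr; exact hx' y
      _ = 1 / 2 * ‖y‖ := by rw [← mul_assoc, hεC]
  have hident : ∀ y, r₂ y = r₂ (fs (fx y)) + r₂ (step y) - d (fw y) := fun y ↦ by
    have h1 := hrel y
    have h2 : r₁ (fx y) = fs (fx y) + step y := by simp [step]
    rw [h2, map_add] at h1
    rw [h1]; abel
  -- the sequence `y_n = stepⁿ y₀`
  let ys : ℕ → Y := fun n ↦ step^[n] y₀
  have hys0 : ys 0 = y₀ := rfl
  have hys_succ : ∀ n, ys (n + 1) = step (ys n) := fun n ↦ iterate_succ_apply' step n y₀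
  have hys_norm : ∀ n, ‖ys n‖ ≤ (1 / 2) ^ n * ‖y₀‖ := fun n ↦ by
    induction n with
    | zero => simp [hys0]
    | succ n ih =>
      rw [hys_succ, pow_succ]
      calc ‖step (ys n)‖ ≤ 1 / 2 * ‖ys n‖ := hstep _
        _ ≤ 1 / 2 * ((1 / 2) ^ n * ‖y₀‖) := by gcongr
        _ = (1 / 2) ^ n * (1 / 2) * ‖y₀‖ := by ring
  -- the two series
  let a : ℕ → Y := fun n ↦ fs (fx (ys n))
  let b : ℕ → W := fun n ↦ fw (ys n)
  have ha_norm : ∀ n, ‖a n‖ ≤ (‖r₁‖ + ε) * C' * ‖y₀‖ * (1 / 2) ^ n := fun n ↦ by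
    have h1 : ‖a n‖ ≤ ‖r₁ (fx (ys n))‖ + ‖r₁ (fx (ys n)) - fs (fx (ys n))‖ := by
      calc ‖a n‖ = ‖r₁ (fx (ys n)) - (r₁ (fx (ys n)) - fs (fx (ys n)))‖ := by simp [a]
        _ ≤ ‖r₁ (fx (ys n))‖ + ‖r₁ (fx (ys n)) - fs (fx (ys n))‖ := norm_sub_le _ _
    have hpos : 0 ≤ ‖r₁‖ + ε := by positivity
    calc ‖a n‖ ≤ ‖r₁‖ * ‖fx (ys n)‖ + ε * ‖fx (ys n)‖ :=
          h1.trans (add_le_add (r₁.le_opNorm _) (hfs _))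
      _ = (‖r₁‖ + ε) * ‖fx (ys n)‖ := by ring
      _ ≤ (‖r₁‖ + ε) * (C' * ((1 / 2) ^ n * ‖y₀‖)) :=
          mul_le_mul_of_nonneg_left
            ((hx' _).trans (mul_le_mul_of_nonneg_left (hys_norm n) hC'0.le)) hpos
      _ = (‖r₁‖ + ε) * C' * ‖y₀‖ * (1 / 2) ^ n := by ring
  have hb_norm : ∀ n, ‖b n‖ ≤ C' * ‖y₀‖ * (1 / 2) ^ n := fun n ↦ by
    calc ‖b n‖ ≤ C' * ‖ys n‖ := hw' _
      _ ≤ C' * ((1 / 2) ^ n * ‖y₀‖) := by gcongr; exact hys_norm n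
      _ = C' * ‖y₀‖ * (1 / 2) ^ n := by ring
  have hgeom : Summable fun n : ℕ ↦ (1 / 2 : ℝ) ^ n :=
    summable_geometric_of_lt_one (by norm_num) (by norm_num)
  have ha : Summable a := Summable.of_norm_bounded (hgeom.mul_left _) ha_norm
  have hb : Summable b := Summable.of_norm_bounded (hgeom.mul_left _) hb_norm
  set s : Y := ∑' n, a n with hsdef
  set w : W := ∑' n, b n with hwdef
  -- `s ∈ S` since `S` is closed
  have hSclosed : IsClosed (S : Set Y) := S.closed_of_finiteDimensional
  have hsS : s ∈ S := by
    refine hSclosed.mem_of_tendsto ha.hasSum.tendsto_sum_nat (Eventually.of_forall fun n ↦ ?_)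
    exact S.sum_mem fun k _ ↦ hfsS _
  -- the telescoped identity
  have hpartial : ∀ n, r₂ y₀ = r₂ (∑ k ∈ Finset.range n, a k) + r₂ (ys n) - d (∑ k ∈ Finset.range n, b k) := by
    intro n
    induction n with
    | zero => simp [hys0]
    | succ n ih =>
      rw [Finset.sum_range_succ, Finset.sum_range_succ, map_add, map_add, hys_succ, ih, hident (ys n)]
      abel
  -- pass to the limit
  have hlim : Tendsto (fun n ↦ r₂ (∑ k ∈ Finset.range n, a k) + r₂ (ys n) - d (∑ k ∈ Finset.range n, b k))
      atTop (𝓝 (r₂ s + 0 - d w)) := by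
    refine ((r₂.continuous.tendsto s |>.comp ha.hasSum.tendsto_sum_nat).add ?_).sub
      (d.continuous.tendsto w |>.comp hb.hasSum.tendsto_sum_nat)
    have h0 : Tendsto (fun n ↦ ys n) atTop (𝓝 0) := by
      refine squeeze_zero_norm hys_norm ?_
      simpa using (tendsto_pow_atTop_nhds_zero_of_lt_one (by norm_num : (0 : ℝ) ≤ 1 / 2)
        (by norm_num)).mul_const ‖y₀‖
    have h1 := (r₂.continuous.tendsto 0).comp h0
    rw [map_zero] at h1
    exact h1
  have hconst : Tendsto (fun _ : ℕ ↦ r₂ y₀) atTop (𝓝 (r₂ s + 0 - d w)) :=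
    hlim.congr fun n ↦ (hpartial n).symm
  have hfinal : r₂ y₀ = r₂ s + 0 - d w := tendsto_nhds_unique tendsto_const_nhds hconst
  refine ⟨s, hsS, -w, ?_⟩
  rw [hfinal, map_neg]; abel

/-- **Glättungslemma + Endlichkeitslemma**: the same conclusion when `X, W, Y` are Banach spaces
and only the SOLVABILITY `∀ y, ∃ x w, r₂ (r₁ x) = r₂ y + d w` is known ("`α` ist … surjektiv", the
Leray isomorphisms) — the norm control is supplied by the open mapping theorem
(`exists_norm_le_of_forall_exists_eq_add`). [cite: GrauertRemmert1977, Kap. VI §4.1–4.2] -/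
theorem exists_finiteDimensional_forall_eq_add_of_isCompactOperator_of_forall_exists
    [CompleteSpace X] [CompleteSpace W] [CompleteSpace Y]
    (r₁ : X →L[𝕜] Y) (r₂ : Y →L[𝕜] V) (d : W →L[𝕜] V) (hr₁ : IsCompactOperator r₁)
    (h : ∀ y : Y, ∃ x : X, ∃ w : W, r₂ (r₁ x) = r₂ y + d w) :
    ∃ S : Submodule 𝕜 Y, FiniteDimensional 𝕜 S ∧ ∀ y : Y, ∃ s ∈ S, ∃ w : W, r₂ y = r₂ s + d w := by
  obtain ⟨C, -, hC⟩ := exists_norm_le_of_forall_exists_eq_add r₁ r₂ d h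
  exact exists_finiteDimensional_forall_eq_add_of_isCompactOperator r₁ r₂ d hr₁ hC

/-! ### The abstract finiteness theorem -/

/-- **Finiteness of cohomology from a compact restriction** (Cartan–Serre (1953) via L. Schwartz;
Grauert–Remmert (1977), Kap. VI §4.3 "Endlichkeitssatz" as corollary of the Endlichkeitslemma;
Forster (1981), Thm. 14.9 — abstract form). In the situation of
`exists_finiteDimensional_forall_eq_add_of_isCompactOperator_of_forall_exists`, let `H` be any
`𝕜`-module ("the cohomology") with a linear `cls : V → H` vanishing on `range d` ("coboundaries are
trivial") and such that every element of `H` is `cls (r₂ y)` for some `y ∈ Y` ("every class is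
represented by a bounded cocycle of the middle cover"). Then `H` is finite-dimensional: it is the
image of the finite-dimensional `S` under `cls ∘ r₂`. [cite: GrauertRemmert1977, Kap. VI §4.3] -/
theorem _root_.Module.finite_of_compact_restriction [CompleteSpace X] [CompleteSpace W] [CompleteSpace Y]
    {H : Type*} [AddCommGroup H] [Module 𝕜 H]
    (r₁ : X →L[𝕜] Y) (r₂ : Y →L[𝕜] V) (d : W →L[𝕜] V) (hr₁ : IsCompactOperator r₁)
    (h : ∀ y : Y, ∃ x : X, ∃ w : W, r₂ (r₁ x) = r₂ y + d w)
    (cls : V →ₗ[𝕜] H) (hd : ∀ w : W, cls (d w) = 0) (hcls : ∀ c : H, ∃ y : Y, cls (r₂ y) = c) :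
    Module.Finite 𝕜 H := by
  obtain ⟨S, hS, hSY⟩ :=
    exists_finiteDimensional_forall_eq_add_of_isCompactOperator_of_forall_exists r₁ r₂ d hr₁ h
  -- `cls ∘ r₂ ∘ S.subtype` is surjective
  let f : S →ₗ[𝕜] H := cls.comp ((r₂ : Y →ₗ[𝕜] V).comp S.subtype)
  refine Module.Finite.of_surjective f fun c ↦ ?_
  obtain ⟨y, rfl⟩ := hcls c
  obtain ⟨s, hsS, w, hw⟩ := hSY y
  refine ⟨⟨s, hsS⟩, ?_⟩
  change cls (r₂ s) = cls (r₂ y)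
  rw [hw, map_add, hd, add_zero]

end

end Literature.Analysis.OperatorTheory
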